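/-
Copyright: the b2b-balaban T⁴-continuum CRUX team, row NE7b OWNER lineage `t4-ne7b-p1` (gen 144). Project licence.
-/
import Mathlib.MeasureTheory.Integral.Bochner.Basic

/-!
# GLUE FOR THE ORDER-FIVE KERNEL LETTER, II — INTEGRAND PERMUTATIONS UNDER THE ROW SUM (SCOPING (d15′)(vi), second file): in the fifth
# derivative's display the tilt observable `A_n = U′(·)e_x` enters every rule output LAST (`Cov(p,∂q)`, `κ₃ᶜ(p,q,A_n)`, `u₄(p,q,r,A_n)`,
# `u₅(·,·,·,·,A_n)`), while the piece files (562)∕(563)∕(575)∕(578)∕(579) carry the row index `x` in the FIRST factor.  For ABSTRACT observables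
# `oᵢ : ι⁴ → Ω → ℝ` with abstract centres `aᵢ : ι⁴ → ℝ`, weight `e`, normalisation `Zi` and measure `μ`, this file proves the identities of
# quadruple row sums of absolute values under the needed permutations of the observables: raw covariance symmetry; the centred triple cyclic
# and under two transpositions; `u₄` written out (centred fourth moment minus three pair products) under four permutations; `u₅` written out
# ((578)'s format: centred fifth moment minus ten pair–triple products) cyclic — the partitions permute among themselves and factors commute
# inside each integrand.  Used by unification, like (522)'s `sum3_*` (row NE7b, node U5c; Mathlib only; [folklore])

Cell `pub-balaban`, sub-cell `t4`, spine estimate NE7b (`T4WeightBudget.RelWeightBound`; the cell's OWN estimate — NOT PRINTED in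
[Bałaban 1983–89], NOT PROVED).  Crux-route work under `Spine/NE7b/` by the row OWNER (`t4-ne7b-p1` gen 144, file (596)) under FREEZE
(0)'s crux-prover clause; NOTHING of Bałaban's is named as a Lean object, valued or asserted; no `T4Continuum/Support` leaf typed; no
`def`, no notation; zero `sorry`.  Imports: Mathlib only.

WHAT IS PROVED ([folklore]): `cov_rowsum_symm`, `cm3_rowsum_cyc`, `cm3_rowsum_swap12`, `cm3_rowsum_swap13`, `u4_rowsum_cyc`, `u4_rowsum_4213`,
`u4_rowsum_swap12`, `u4_rowsum_3124`, **`u5_rowsum_cyc`**; toy.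

HONEST (what this is NOT).  Commutativity inside integrands and of real products: NOT a bound on anything; the group row letters and the
order-5 kernel letter are the next files.  Scalar skeleton ((A3), NC-NE7b-α UNRULED); nothing of Bałaban's
asserted.  BY-NAME EFFECT ON THE WALL: NONE.  NE7b NOT PRINTED ∕ NOT PROVED; spine PROVED 0∕9; rung (B)+1 — the programme's measures remain
FINITE-torus statements; NOT the mass gap, NOT Clay.  HONEST DEPENDENCY: continuum YM on T⁴ ⇐ BetaPertH ∧ nine spine estimates (0∕9 proved);
BetaPertH ⇐ (D1) ∧ (D4) ∧ CAP+tail; G-an2-4 gates asym, D1 and NE2∕3∕4.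
-/

set_option autoImplicit false

noncomputable section

namespace Summit.QuantumFields.BalabanUV.T4Continuum.NE7b.SupFifthKernelPermutations

open MeasureTheory Finset
open scoped BigOperators

variable {ι : Type} [Fintype ι] [DecidableEq ι]

/-! ## §1. Integrand permutations under the row sum (abstract observables) -/

section Permutations

variable {Ω : Type*} [MeasurableSpace Ω]

omit [DecidableEq ι] in
/-- **Raw covariance symmetry under the row sum**: `Cov(p,q) = Cov(q,p)` in the raw format `Z⁻¹∫epq − Z⁻²∫ep∫eq`, summed in absolute
value over four site indices (the factor carrying the row index moves to the front). [folklore] -/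
theorem cov_rowsum_symm (μ : Measure Ω) (e : Ω → ℝ) (Zi Zi2 : ℝ) (p q : ι → ι → ι → ι → Ω → ℝ) :
    ∑ y, ∑ z, ∑ t, ∑ s, |Zi * (∫ ω, e ω * (p y z t s ω * q y z t s ω) ∂μ) -
        Zi2 * ((∫ ω, e ω * p y z t s ω ∂μ) * (∫ ω, e ω * q y z t s ω ∂μ))| =
      ∑ y, ∑ z, ∑ t, ∑ s, |Zi * (∫ ω, e ω * (q y z t s ω * p y z t s ω) ∂μ) -
        Zi2 * ((∫ ω, e ω * q y z t s ω ∂μ) * (∫ ω, e ω * p y z t s ω ∂μ))| := by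
  refine Finset.sum_congr rfl fun y _ => Finset.sum_congr rfl fun z _ => Finset.sum_congr rfl fun t _ => Finset.sum_congr rfl fun s _ => ?_
  have i1 : (∫ ω, e ω * (p y z t s ω * q y z t s ω) ∂μ) = ∫ ω, e ω * (q y z t s ω * p y z t s ω) ∂μ :=
    integral_congr_ae (Filter.Eventually.of_forall fun ω => by ring)
  rw [i1, mul_comm (∫ ω, e ω * p y z t s ω ∂μ)]

omit [DecidableEq ι] in
/-- **Centred triple, last factor to the front**: `κ₃ᶜ(p,q,r) = κ₃ᶜ(r,p,q)` under the row sum (commutativity inside the integrand). [folklore] -/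
theorem cm3_rowsum_cyc (μ : Measure Ω) (e : Ω → ℝ) (Zi : ℝ) (o1 o2 o3 : ι → ι → ι → ι → Ω → ℝ)
    (a1 a2 a3 : ι → ι → ι → ι → ℝ) :
    ∑ y, ∑ z, ∑ t, ∑ s, |(Zi * (∫ ω, e ω * ((o1 y z t s ω - a1 y z t s) * (o2 y z t s ω - a2 y z t s) * (o3 y z t s ω - a3 y z t s)) ∂μ))| =
      ∑ y, ∑ z, ∑ t, ∑ s, |(Zi * (∫ ω, e ω * ((o3 y z t s ω - a3 y z t s) * (o1 y z t s ω - a1 y z t s) * (o2 y z t s ω - a2 y z t s)) ∂μ))| := by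
  refine Finset.sum_congr rfl fun y _ => Finset.sum_congr rfl fun z _ => Finset.sum_congr rfl fun t _ => Finset.sum_congr rfl fun s _ => ?_
  have i1 : (∫ ω, e ω * ((o1 y z t s ω - a1 y z t s) * (o2 y z t s ω - a2 y z t s) * (o3 y z t s ω - a3 y z t s)) ∂μ) =
      (∫ ω, e ω * ((o3 y z t s ω - a3 y z t s) * (o1 y z t s ω - a1 y z t s) * (o2 y z t s ω - a2 y z t s)) ∂μ) :=
    integral_congr_ae (Filter.Eventually.of_forall fun ω => by ring)
  rw [i1]

omit [DecidableEq ι] in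
/-- **Centred triple, first two factors exchanged**: `κ₃ᶜ(p,q,r) = κ₃ᶜ(q,p,r)` under the row sum. [folklore] -/
theorem cm3_rowsum_swap12 (μ : Measure Ω) (e : Ω → ℝ) (Zi : ℝ) (o1 o2 o3 : ι → ι → ι → ι → Ω → ℝ)
    (a1 a2 a3 : ι → ι → ι → ι → ℝ) :
    ∑ y, ∑ z, ∑ t, ∑ s, |(Zi * (∫ ω, e ω * ((o1 y z t s ω - a1 y z t s) * (o2 y z t s ω - a2 y z t s) * (o3 y z t s ω - a3 y z t s)) ∂μ))| =
      ∑ y, ∑ z, ∑ t, ∑ s, |(Zi * (∫ ω, e ω * ((o2 y z t s ω - a2 y z t s) * (o1 y z t s ω - a1 y z t s) * (o3 y z t s ω - a3 y z t s)) ∂μ))| := by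
  refine Finset.sum_congr rfl fun y _ => Finset.sum_congr rfl fun z _ => Finset.sum_congr rfl fun t _ => Finset.sum_congr rfl fun s _ => ?_
  have i1 : (∫ ω, e ω * ((o1 y z t s ω - a1 y z t s) * (o2 y z t s ω - a2 y z t s) * (o3 y z t s ω - a3 y z t s)) ∂μ) =
      (∫ ω, e ω * ((o2 y z t s ω - a2 y z t s) * (o1 y z t s ω - a1 y z t s) * (o3 y z t s ω - a3 y z t s)) ∂μ) :=
    integral_congr_ae (Filter.Eventually.of_forall fun ω => by ring)
  rw [i1]

omit [DecidableEq ι] in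
/-- **Centred triple, outer factors exchanged**: `κ₃ᶜ(p,q,r) = κ₃ᶜ(r,q,p)` under the row sum. [folklore] -/
theorem cm3_rowsum_swap13 (μ : Measure Ω) (e : Ω → ℝ) (Zi : ℝ) (o1 o2 o3 : ι → ι → ι → ι → Ω → ℝ)
    (a1 a2 a3 : ι → ι → ι → ι → ℝ) :
    ∑ y, ∑ z, ∑ t, ∑ s, |(Zi * (∫ ω, e ω * ((o1 y z t s ω - a1 y z t s) * (o2 y z t s ω - a2 y z t s) * (o3 y z t s ω - a3 y z t s)) ∂μ))| =
      ∑ y, ∑ z, ∑ t, ∑ s, |(Zi * (∫ ω, e ω * ((o3 y z t s ω - a3 y z t s) * (o2 y z t s ω - a2 y z t s) * (o1 y z t s ω - a1 y z t s)) ∂μ))| := by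
  refine Finset.sum_congr rfl fun y _ => Finset.sum_congr rfl fun z _ => Finset.sum_congr rfl fun t _ => Finset.sum_congr rfl fun s _ => ?_
  have i1 : (∫ ω, e ω * ((o1 y z t s ω - a1 y z t s) * (o2 y z t s ω - a2 y z t s) * (o3 y z t s ω - a3 y z t s)) ∂μ) =
      (∫ ω, e ω * ((o3 y z t s ω - a3 y z t s) * (o2 y z t s ω - a2 y z t s) * (o1 y z t s ω - a1 y z t s)) ∂μ) :=
    integral_congr_ae (Filter.Eventually.of_forall fun ω => by ring)
  rw [i1]

omit [DecidableEq ι] in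
/-- **`u₄`, last observable to the front**: `u₄(p,q,r,w) = u₄(w,p,q,r)` written out (centred fourth moment minus the three products of
centred pair moments) under the row sum — the pair partition is permuted, factors commute inside the integrands. [folklore] -/
theorem u4_rowsum_cyc (μ : Measure Ω) (e : Ω → ℝ) (Zi : ℝ) (o1 o2 o3 o4 : ι → ι → ι → ι → Ω → ℝ)
    (a1 a2 a3 a4 : ι → ι → ι → ι → ℝ) :
    ∑ y, ∑ z, ∑ t, ∑ s, |((Zi * (∫ ω, e ω * ((o1 y z t s ω - a1 y z t s) * (o2 y z t s ω - a2 y z t s) * (o3 y z t s ω - a3 y z t s) * (o4 y z t s ω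
        - a4 y z t s)) ∂μ)) - (Zi * (∫ ω, e ω * ((o1 y z t s ω - a1 y z t s) * (o2 y z t s ω - a2 y z t s)) ∂μ)) * (Zi * (∫ ω, e ω * ((o3 y z t s ω -
        a3 y z t s) * (o4 y z t s ω - a4 y z t s)) ∂μ)) - (Zi * (∫ ω, e ω * ((o1 y z t s ω - a1 y z t s) * (o3 y z t s ω - a3 y z t s)) ∂μ)) * (Zi *
        (∫ ω, e ω * ((o2 y z t s ω - a2 y z t s) * (o4 y z t s ω - a4 y z t s)) ∂μ)) - (Zi * (∫ ω, e ω * ((o1 y z t s ω - a1 y z t s) * (o4 y z t s ω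
        - a4 y z t s)) ∂μ)) * (Zi * (∫ ω, e ω * ((o2 y z t s ω - a2 y z t s) * (o3 y z t s ω - a3 y z t s)) ∂μ)))| =
      ∑ y, ∑ z, ∑ t, ∑ s, |((Zi * (∫ ω, e ω * ((o4 y z t s ω - a4 y z t s) * (o1 y z t s ω - a1 y z t s) * (o2 y z t s ω - a2 y z t s) * (o3 y z t s
          ω - a3 y z t s)) ∂μ)) - (Zi * (∫ ω, e ω * ((o4 y z t s ω - a4 y z t s) * (o1 y z t s ω - a1 y z t s)) ∂μ)) * (Zi * (∫ ω, e ω * ((o2 y z t s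
          ω - a2 y z t s) * (o3 y z t s ω - a3 y z t s)) ∂μ)) - (Zi * (∫ ω, e ω * ((o4 y z t s ω - a4 y z t s) * (o2 y z t s ω - a2 y z t s)) ∂μ)) *
          (Zi * (∫ ω, e ω * ((o1 y z t s ω - a1 y z t s) * (o3 y z t s ω - a3 y z t s)) ∂μ)) - (Zi * (∫ ω, e ω * ((o4 y z t s ω - a4 y z t s) * (o3 y
          z t s ω - a3 y z t s)) ∂μ)) * (Zi * (∫ ω, e ω * ((o1 y z t s ω - a1 y z t s) * (o2 y z t s ω - a2 y z t s)) ∂μ)))| := by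
  refine Finset.sum_congr rfl fun y _ => Finset.sum_congr rfl fun z _ => Finset.sum_congr rfl fun t _ => Finset.sum_congr rfl fun s _ => ?_
  have i1 : (∫ ω, e ω * ((o1 y z t s ω - a1 y z t s) * (o2 y z t s ω - a2 y z t s) * (o3 y z t s ω - a3 y z t s) * (o4 y z t s ω - a4 y z t s)) ∂μ) =
      (∫ ω, e ω * ((o4 y z t s ω - a4 y z t s) * (o1 y z t s ω - a1 y z t s) * (o2 y z t s ω - a2 y z t s) * (o3 y z t s ω - a3 y z t s)) ∂μ) :=
    integral_congr_ae (Filter.Eventually.of_forall fun ω => by ring)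
  have i3 : (∫ ω, e ω * ((o3 y z t s ω - a3 y z t s) * (o4 y z t s ω - a4 y z t s)) ∂μ) =
      (∫ ω, e ω * ((o4 y z t s ω - a4 y z t s) * (o3 y z t s ω - a3 y z t s)) ∂μ) :=
    integral_congr_ae (Filter.Eventually.of_forall fun ω => by ring)
  have i5 : (∫ ω, e ω * ((o2 y z t s ω - a2 y z t s) * (o4 y z t s ω - a4 y z t s)) ∂μ) =
      (∫ ω, e ω * ((o4 y z t s ω - a4 y z t s) * (o2 y z t s ω - a2 y z t s)) ∂μ) :=
    integral_congr_ae (Filter.Eventually.of_forall fun ω => by ring)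
  have i6 : (∫ ω, e ω * ((o1 y z t s ω - a1 y z t s) * (o4 y z t s ω - a4 y z t s)) ∂μ) =
      (∫ ω, e ω * ((o4 y z t s ω - a4 y z t s) * (o1 y z t s ω - a1 y z t s)) ∂μ) :=
    integral_congr_ae (Filter.Eventually.of_forall fun ω => by ring)
  rw [i1, i3, i5, i6]
  congr 1
  ring

omit [DecidableEq ι] in
/-- **`u₄(p,q,r,w) = u₄(w,q,p,r)`** written out, under the row sum. [folklore] -/
theorem u4_rowsum_4213 (μ : Measure Ω) (e : Ω → ℝ) (Zi : ℝ) (o1 o2 o3 o4 : ι → ι → ι → ι → Ω → ℝ)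
    (a1 a2 a3 a4 : ι → ι → ι → ι → ℝ) :
    ∑ y, ∑ z, ∑ t, ∑ s, |((Zi * (∫ ω, e ω * ((o1 y z t s ω - a1 y z t s) * (o2 y z t s ω - a2 y z t s) * (o3 y z t s ω - a3 y z t s) * (o4 y z t s ω
        - a4 y z t s)) ∂μ)) - (Zi * (∫ ω, e ω * ((o1 y z t s ω - a1 y z t s) * (o2 y z t s ω - a2 y z t s)) ∂μ)) * (Zi * (∫ ω, e ω * ((o3 y z t s ω -
        a3 y z t s) * (o4 y z t s ω - a4 y z t s)) ∂μ)) - (Zi * (∫ ω, e ω * ((o1 y z t s ω - a1 y z t s) * (o3 y z t s ω - a3 y z t s)) ∂μ)) * (Zi *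
        (∫ ω, e ω * ((o2 y z t s ω - a2 y z t s) * (o4 y z t s ω - a4 y z t s)) ∂μ)) - (Zi * (∫ ω, e ω * ((o1 y z t s ω - a1 y z t s) * (o4 y z t s ω
        - a4 y z t s)) ∂μ)) * (Zi * (∫ ω, e ω * ((o2 y z t s ω - a2 y z t s) * (o3 y z t s ω - a3 y z t s)) ∂μ)))| =
      ∑ y, ∑ z, ∑ t, ∑ s, |((Zi * (∫ ω, e ω * ((o4 y z t s ω - a4 y z t s) * (o2 y z t s ω - a2 y z t s) * (o1 y z t s ω - a1 y z t s) * (o3 y z t s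
          ω - a3 y z t s)) ∂μ)) - (Zi * (∫ ω, e ω * ((o4 y z t s ω - a4 y z t s) * (o2 y z t s ω - a2 y z t s)) ∂μ)) * (Zi * (∫ ω, e ω * ((o1 y z t s
          ω - a1 y z t s) * (o3 y z t s ω - a3 y z t s)) ∂μ)) - (Zi * (∫ ω, e ω * ((o4 y z t s ω - a4 y z t s) * (o1 y z t s ω - a1 y z t s)) ∂μ)) *
          (Zi * (∫ ω, e ω * ((o2 y z t s ω - a2 y z t s) * (o3 y z t s ω - a3 y z t s)) ∂μ)) - (Zi * (∫ ω, e ω * ((o4 y z t s ω - a4 y z t s) * (o3 y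
          z t s ω - a3 y z t s)) ∂μ)) * (Zi * (∫ ω, e ω * ((o2 y z t s ω - a2 y z t s) * (o1 y z t s ω - a1 y z t s)) ∂μ)))| := by
  refine Finset.sum_congr rfl fun y _ => Finset.sum_congr rfl fun z _ => Finset.sum_congr rfl fun t _ => Finset.sum_congr rfl fun s _ => ?_
  have i1 : (∫ ω, e ω * ((o1 y z t s ω - a1 y z t s) * (o2 y z t s ω - a2 y z t s) * (o3 y z t s ω - a3 y z t s) * (o4 y z t s ω - a4 y z t s)) ∂μ) =
      (∫ ω, e ω * ((o4 y z t s ω - a4 y z t s) * (o2 y z t s ω - a2 y z t s) * (o1 y z t s ω - a1 y z t s) * (o3 y z t s ω - a3 y z t s)) ∂μ) :=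
    integral_congr_ae (Filter.Eventually.of_forall fun ω => by ring)
  have i2 : (∫ ω, e ω * ((o1 y z t s ω - a1 y z t s) * (o2 y z t s ω - a2 y z t s)) ∂μ) =
      (∫ ω, e ω * ((o2 y z t s ω - a2 y z t s) * (o1 y z t s ω - a1 y z t s)) ∂μ) :=
    integral_congr_ae (Filter.Eventually.of_forall fun ω => by ring)
  have i3 : (∫ ω, e ω * ((o3 y z t s ω - a3 y z t s) * (o4 y z t s ω - a4 y z t s)) ∂μ) =
      (∫ ω, e ω * ((o4 y z t s ω - a4 y z t s) * (o3 y z t s ω - a3 y z t s)) ∂μ) :=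
    integral_congr_ae (Filter.Eventually.of_forall fun ω => by ring)
  have i5 : (∫ ω, e ω * ((o2 y z t s ω - a2 y z t s) * (o4 y z t s ω - a4 y z t s)) ∂μ) =
      (∫ ω, e ω * ((o4 y z t s ω - a4 y z t s) * (o2 y z t s ω - a2 y z t s)) ∂μ) :=
    integral_congr_ae (Filter.Eventually.of_forall fun ω => by ring)
  have i6 : (∫ ω, e ω * ((o1 y z t s ω - a1 y z t s) * (o4 y z t s ω - a4 y z t s)) ∂μ) =
      (∫ ω, e ω * ((o4 y z t s ω - a4 y z t s) * (o1 y z t s ω - a1 y z t s)) ∂μ) :=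
    integral_congr_ae (Filter.Eventually.of_forall fun ω => by ring)
  rw [i1, i2, i3, i5, i6]
  congr 1
  ring

omit [DecidableEq ι] in
/-- **`u₄(p,q,r,w) = u₄(q,p,r,w)`** written out, under the row sum. [folklore] -/
theorem u4_rowsum_swap12 (μ : Measure Ω) (e : Ω → ℝ) (Zi : ℝ) (o1 o2 o3 o4 : ι → ι → ι → ι → Ω → ℝ)
    (a1 a2 a3 a4 : ι → ι → ι → ι → ℝ) :
    ∑ y, ∑ z, ∑ t, ∑ s, |((Zi * (∫ ω, e ω * ((o1 y z t s ω - a1 y z t s) * (o2 y z t s ω - a2 y z t s) * (o3 y z t s ω - a3 y z t s) * (o4 y z t s ω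
        - a4 y z t s)) ∂μ)) - (Zi * (∫ ω, e ω * ((o1 y z t s ω - a1 y z t s) * (o2 y z t s ω - a2 y z t s)) ∂μ)) * (Zi * (∫ ω, e ω * ((o3 y z t s ω -
        a3 y z t s) * (o4 y z t s ω - a4 y z t s)) ∂μ)) - (Zi * (∫ ω, e ω * ((o1 y z t s ω - a1 y z t s) * (o3 y z t s ω - a3 y z t s)) ∂μ)) * (Zi *
        (∫ ω, e ω * ((o2 y z t s ω - a2 y z t s) * (o4 y z t s ω - a4 y z t s)) ∂μ)) - (Zi * (∫ ω, e ω * ((o1 y z t s ω - a1 y z t s) * (o4 y z t s ω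
        - a4 y z t s)) ∂μ)) * (Zi * (∫ ω, e ω * ((o2 y z t s ω - a2 y z t s) * (o3 y z t s ω - a3 y z t s)) ∂μ)))| =
      ∑ y, ∑ z, ∑ t, ∑ s, |((Zi * (∫ ω, e ω * ((o2 y z t s ω - a2 y z t s) * (o1 y z t s ω - a1 y z t s) * (o3 y z t s ω - a3 y z t s) * (o4 y z t s
          ω - a4 y z t s)) ∂μ)) - (Zi * (∫ ω, e ω * ((o2 y z t s ω - a2 y z t s) * (o1 y z t s ω - a1 y z t s)) ∂μ)) * (Zi * (∫ ω, e ω * ((o3 y z t s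
          ω - a3 y z t s) * (o4 y z t s ω - a4 y z t s)) ∂μ)) - (Zi * (∫ ω, e ω * ((o2 y z t s ω - a2 y z t s) * (o3 y z t s ω - a3 y z t s)) ∂μ)) *
          (Zi * (∫ ω, e ω * ((o1 y z t s ω - a1 y z t s) * (o4 y z t s ω - a4 y z t s)) ∂μ)) - (Zi * (∫ ω, e ω * ((o2 y z t s ω - a2 y z t s) * (o4 y
          z t s ω - a4 y z t s)) ∂μ)) * (Zi * (∫ ω, e ω * ((o1 y z t s ω - a1 y z t s) * (o3 y z t s ω - a3 y z t s)) ∂μ)))| := by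
  refine Finset.sum_congr rfl fun y _ => Finset.sum_congr rfl fun z _ => Finset.sum_congr rfl fun t _ => Finset.sum_congr rfl fun s _ => ?_
  have i1 : (∫ ω, e ω * ((o1 y z t s ω - a1 y z t s) * (o2 y z t s ω - a2 y z t s) * (o3 y z t s ω - a3 y z t s) * (o4 y z t s ω - a4 y z t s)) ∂μ) =
      (∫ ω, e ω * ((o2 y z t s ω - a2 y z t s) * (o1 y z t s ω - a1 y z t s) * (o3 y z t s ω - a3 y z t s) * (o4 y z t s ω - a4 y z t s)) ∂μ) :=
    integral_congr_ae (Filter.Eventually.of_forall fun ω => by ring)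
  have i2 : (∫ ω, e ω * ((o1 y z t s ω - a1 y z t s) * (o2 y z t s ω - a2 y z t s)) ∂μ) =
      (∫ ω, e ω * ((o2 y z t s ω - a2 y z t s) * (o1 y z t s ω - a1 y z t s)) ∂μ) :=
    integral_congr_ae (Filter.Eventually.of_forall fun ω => by ring)
  rw [i1, i2]
  congr 1
  ring

omit [DecidableEq ι] in
/-- **`u₄(p,q,r,w) = u₄(r,p,q,w)`** written out, under the row sum. [folklore] -/
theorem u4_rowsum_3124 (μ : Measure Ω) (e : Ω → ℝ) (Zi : ℝ) (o1 o2 o3 o4 : ι → ι → ι → ι → Ω → ℝ)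
    (a1 a2 a3 a4 : ι → ι → ι → ι → ℝ) :
    ∑ y, ∑ z, ∑ t, ∑ s, |((Zi * (∫ ω, e ω * ((o1 y z t s ω - a1 y z t s) * (o2 y z t s ω - a2 y z t s) * (o3 y z t s ω - a3 y z t s) * (o4 y z t s ω
        - a4 y z t s)) ∂μ)) - (Zi * (∫ ω, e ω * ((o1 y z t s ω - a1 y z t s) * (o2 y z t s ω - a2 y z t s)) ∂μ)) * (Zi * (∫ ω, e ω * ((o3 y z t s ω -
        a3 y z t s) * (o4 y z t s ω - a4 y z t s)) ∂μ)) - (Zi * (∫ ω, e ω * ((o1 y z t s ω - a1 y z t s) * (o3 y z t s ω - a3 y z t s)) ∂μ)) * (Zi *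
        (∫ ω, e ω * ((o2 y z t s ω - a2 y z t s) * (o4 y z t s ω - a4 y z t s)) ∂μ)) - (Zi * (∫ ω, e ω * ((o1 y z t s ω - a1 y z t s) * (o4 y z t s ω
        - a4 y z t s)) ∂μ)) * (Zi * (∫ ω, e ω * ((o2 y z t s ω - a2 y z t s) * (o3 y z t s ω - a3 y z t s)) ∂μ)))| =
      ∑ y, ∑ z, ∑ t, ∑ s, |((Zi * (∫ ω, e ω * ((o3 y z t s ω - a3 y z t s) * (o1 y z t s ω - a1 y z t s) * (o2 y z t s ω - a2 y z t s) * (o4 y z t s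
          ω - a4 y z t s)) ∂μ)) - (Zi * (∫ ω, e ω * ((o3 y z t s ω - a3 y z t s) * (o1 y z t s ω - a1 y z t s)) ∂μ)) * (Zi * (∫ ω, e ω * ((o2 y z t s
          ω - a2 y z t s) * (o4 y z t s ω - a4 y z t s)) ∂μ)) - (Zi * (∫ ω, e ω * ((o3 y z t s ω - a3 y z t s) * (o2 y z t s ω - a2 y z t s)) ∂μ)) *
          (Zi * (∫ ω, e ω * ((o1 y z t s ω - a1 y z t s) * (o4 y z t s ω - a4 y z t s)) ∂μ)) - (Zi * (∫ ω, e ω * ((o3 y z t s ω - a3 y z t s) * (o4 y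
          z t s ω - a4 y z t s)) ∂μ)) * (Zi * (∫ ω, e ω * ((o1 y z t s ω - a1 y z t s) * (o2 y z t s ω - a2 y z t s)) ∂μ)))| := by
  refine Finset.sum_congr rfl fun y _ => Finset.sum_congr rfl fun z _ => Finset.sum_congr rfl fun t _ => Finset.sum_congr rfl fun s _ => ?_
  have i1 : (∫ ω, e ω * ((o1 y z t s ω - a1 y z t s) * (o2 y z t s ω - a2 y z t s) * (o3 y z t s ω - a3 y z t s) * (o4 y z t s ω - a4 y z t s)) ∂μ) =
      (∫ ω, e ω * ((o3 y z t s ω - a3 y z t s) * (o1 y z t s ω - a1 y z t s) * (o2 y z t s ω - a2 y z t s) * (o4 y z t s ω - a4 y z t s)) ∂μ) :=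
    integral_congr_ae (Filter.Eventually.of_forall fun ω => by ring)
  have i4 : (∫ ω, e ω * ((o1 y z t s ω - a1 y z t s) * (o3 y z t s ω - a3 y z t s)) ∂μ) =
      (∫ ω, e ω * ((o3 y z t s ω - a3 y z t s) * (o1 y z t s ω - a1 y z t s)) ∂μ) :=
    integral_congr_ae (Filter.Eventually.of_forall fun ω => by ring)
  have i7 : (∫ ω, e ω * ((o2 y z t s ω - a2 y z t s) * (o3 y z t s ω - a3 y z t s)) ∂μ) =
      (∫ ω, e ω * ((o3 y z t s ω - a3 y z t s) * (o2 y z t s ω - a2 y z t s)) ∂μ) :=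
    integral_congr_ae (Filter.Eventually.of_forall fun ω => by ring)
  rw [i1, i4, i7]
  congr 1
  ring

omit [DecidableEq ι] in
/-- **`u₅`, last observable to the front**: `u₅(o₁,…,o₅) = u₅(o₅,o₁,…,o₄)` written out (centred fifth moment minus the ten products of
centred pair and triple moments, (578)'s format) under the row sum — the ten pair–triple partitions are permuted among themselves. [folklore] -/
theorem u5_rowsum_cyc (μ : Measure Ω) (e : Ω → ℝ) (Zi : ℝ) (o1 o2 o3 o4 o5 : ι → ι → ι → ι → Ω → ℝ)
    (a1 a2 a3 a4 a5 : ι → ι → ι → ι → ℝ) :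
    ∑ y, ∑ z, ∑ t, ∑ s, |((Zi * (∫ ω, e ω * ((o1 y z t s ω - a1 y z t s) * (o2 y z t s ω - a2 y z t s) * (o3 y z t s ω - a3 y z t s) * (o4 y z t s ω
        - a4 y z t s) * (o5 y z t s ω - a5 y z t s)) ∂μ)) -
        ((Zi * (∫ ω, e ω * ((o1 y z t s ω - a1 y z t s) * (o2 y z t s ω - a2 y z t s)) ∂μ)) * (Zi * (∫ ω, e ω * ((o3 y z t s ω - a3 y z t s) * (o4 y
            z t s ω - a4 y z t s) * (o5 y z t s ω - a5 y z t s)) ∂μ)) +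
        (Zi * (∫ ω, e ω * ((o1 y z t s ω - a1 y z t s) * (o3 y z t s ω - a3 y z t s)) ∂μ)) * (Zi * (∫ ω, e ω * ((o2 y z t s ω - a2 y z t s) * (o4 y z
            t s ω - a4 y z t s) * (o5 y z t s ω - a5 y z t s)) ∂μ)) +
        (Zi * (∫ ω, e ω * ((o1 y z t s ω - a1 y z t s) * (o4 y z t s ω - a4 y z t s)) ∂μ)) * (Zi * (∫ ω, e ω * ((o2 y z t s ω - a2 y z t s) * (o3 y z
            t s ω - a3 y z t s) * (o5 y z t s ω - a5 y z t s)) ∂μ)) +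
        (Zi * (∫ ω, e ω * ((o1 y z t s ω - a1 y z t s) * (o5 y z t s ω - a5 y z t s)) ∂μ)) * (Zi * (∫ ω, e ω * ((o2 y z t s ω - a2 y z t s) * (o3 y z
            t s ω - a3 y z t s) * (o4 y z t s ω - a4 y z t s)) ∂μ)) +
        (Zi * (∫ ω, e ω * ((o2 y z t s ω - a2 y z t s) * (o3 y z t s ω - a3 y z t s)) ∂μ)) * (Zi * (∫ ω, e ω * ((o1 y z t s ω - a1 y z t s) * (o4 y z
            t s ω - a4 y z t s) * (o5 y z t s ω - a5 y z t s)) ∂μ)) +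
        (Zi * (∫ ω, e ω * ((o2 y z t s ω - a2 y z t s) * (o4 y z t s ω - a4 y z t s)) ∂μ)) * (Zi * (∫ ω, e ω * ((o1 y z t s ω - a1 y z t s) * (o3 y z
            t s ω - a3 y z t s) * (o5 y z t s ω - a5 y z t s)) ∂μ)) +
        (Zi * (∫ ω, e ω * ((o2 y z t s ω - a2 y z t s) * (o5 y z t s ω - a5 y z t s)) ∂μ)) * (Zi * (∫ ω, e ω * ((o1 y z t s ω - a1 y z t s) * (o3 y z
            t s ω - a3 y z t s) * (o4 y z t s ω - a4 y z t s)) ∂μ)) +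
        (Zi * (∫ ω, e ω * ((o3 y z t s ω - a3 y z t s) * (o4 y z t s ω - a4 y z t s)) ∂μ)) * (Zi * (∫ ω, e ω * ((o1 y z t s ω - a1 y z t s) * (o2 y z
            t s ω - a2 y z t s) * (o5 y z t s ω - a5 y z t s)) ∂μ)) +
        (Zi * (∫ ω, e ω * ((o3 y z t s ω - a3 y z t s) * (o5 y z t s ω - a5 y z t s)) ∂μ)) * (Zi * (∫ ω, e ω * ((o1 y z t s ω - a1 y z t s) * (o2 y z
            t s ω - a2 y z t s) * (o4 y z t s ω - a4 y z t s)) ∂μ)) +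
        (Zi * (∫ ω, e ω * ((o4 y z t s ω - a4 y z t s) * (o5 y z t s ω - a5 y z t s)) ∂μ)) * (Zi * (∫ ω, e ω * ((o1 y z t s ω - a1 y z t s) * (o2 y z
            t s ω - a2 y z t s) * (o3 y z t s ω - a3 y z t s)) ∂μ))))| =
      ∑ y, ∑ z, ∑ t, ∑ s, |((Zi * (∫ ω, e ω * ((o5 y z t s ω - a5 y z t s) * (o1 y z t s ω - a1 y z t s) * (o2 y z t s ω - a2 y z t s) * (o3 y z t s
          ω - a3 y z t s) * (o4 y z t s ω - a4 y z t s)) ∂μ)) -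
        ((Zi * (∫ ω, e ω * ((o5 y z t s ω - a5 y z t s) * (o1 y z t s ω - a1 y z t s)) ∂μ)) * (Zi * (∫ ω, e ω * ((o2 y z t s ω - a2 y z t s) * (o3 y
            z t s ω - a3 y z t s) * (o4 y z t s ω - a4 y z t s)) ∂μ)) +
        (Zi * (∫ ω, e ω * ((o5 y z t s ω - a5 y z t s) * (o2 y z t s ω - a2 y z t s)) ∂μ)) * (Zi * (∫ ω, e ω * ((o1 y z t s ω - a1 y z t s) * (o3 y z
            t s ω - a3 y z t s) * (o4 y z t s ω - a4 y z t s)) ∂μ)) +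
        (Zi * (∫ ω, e ω * ((o5 y z t s ω - a5 y z t s) * (o3 y z t s ω - a3 y z t s)) ∂μ)) * (Zi * (∫ ω, e ω * ((o1 y z t s ω - a1 y z t s) * (o2 y z
            t s ω - a2 y z t s) * (o4 y z t s ω - a4 y z t s)) ∂μ)) +
        (Zi * (∫ ω, e ω * ((o5 y z t s ω - a5 y z t s) * (o4 y z t s ω - a4 y z t s)) ∂μ)) * (Zi * (∫ ω, e ω * ((o1 y z t s ω - a1 y z t s) * (o2 y z
            t s ω - a2 y z t s) * (o3 y z t s ω - a3 y z t s)) ∂μ)) +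
        (Zi * (∫ ω, e ω * ((o1 y z t s ω - a1 y z t s) * (o2 y z t s ω - a2 y z t s)) ∂μ)) * (Zi * (∫ ω, e ω * ((o5 y z t s ω - a5 y z t s) * (o3 y z
            t s ω - a3 y z t s) * (o4 y z t s ω - a4 y z t s)) ∂μ)) +
        (Zi * (∫ ω, e ω * ((o1 y z t s ω - a1 y z t s) * (o3 y z t s ω - a3 y z t s)) ∂μ)) * (Zi * (∫ ω, e ω * ((o5 y z t s ω - a5 y z t s) * (o2 y z
            t s ω - a2 y z t s) * (o4 y z t s ω - a4 y z t s)) ∂μ)) +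
        (Zi * (∫ ω, e ω * ((o1 y z t s ω - a1 y z t s) * (o4 y z t s ω - a4 y z t s)) ∂μ)) * (Zi * (∫ ω, e ω * ((o5 y z t s ω - a5 y z t s) * (o2 y z
            t s ω - a2 y z t s) * (o3 y z t s ω - a3 y z t s)) ∂μ)) +
        (Zi * (∫ ω, e ω * ((o2 y z t s ω - a2 y z t s) * (o3 y z t s ω - a3 y z t s)) ∂μ)) * (Zi * (∫ ω, e ω * ((o5 y z t s ω - a5 y z t s) * (o1 y z
            t s ω - a1 y z t s) * (o4 y z t s ω - a4 y z t s)) ∂μ)) +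
        (Zi * (∫ ω, e ω * ((o2 y z t s ω - a2 y z t s) * (o4 y z t s ω - a4 y z t s)) ∂μ)) * (Zi * (∫ ω, e ω * ((o5 y z t s ω - a5 y z t s) * (o1 y z
            t s ω - a1 y z t s) * (o3 y z t s ω - a3 y z t s)) ∂μ)) +
        (Zi * (∫ ω, e ω * ((o3 y z t s ω - a3 y z t s) * (o4 y z t s ω - a4 y z t s)) ∂μ)) * (Zi * (∫ ω, e ω * ((o5 y z t s ω - a5 y z t s) * (o1 y z
            t s ω - a1 y z t s) * (o2 y z t s ω - a2 y z t s)) ∂μ))))| := by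
  refine Finset.sum_congr rfl fun y _ => Finset.sum_congr rfl fun z _ => Finset.sum_congr rfl fun t _ => Finset.sum_congr rfl fun s _ => ?_
  have i1 : (∫ ω, e ω * ((o1 y z t s ω - a1 y z t s) * (o2 y z t s ω - a2 y z t s) * (o3 y z t s ω - a3 y z t s) * (o4 y z t s ω - a4 y z t s) * (o5
      y z t s ω - a5 y z t s)) ∂μ) =
      (∫ ω, e ω * ((o5 y z t s ω - a5 y z t s) * (o1 y z t s ω - a1 y z t s) * (o2 y z t s ω - a2 y z t s) * (o3 y z t s ω - a3 y z t s) * (o4 y z t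
          s ω - a4 y z t s)) ∂μ) :=
    integral_congr_ae (Filter.Eventually.of_forall fun ω => by ring)
  have i3 : (∫ ω, e ω * ((o3 y z t s ω - a3 y z t s) * (o4 y z t s ω - a4 y z t s) * (o5 y z t s ω - a5 y z t s)) ∂μ) =
      (∫ ω, e ω * ((o5 y z t s ω - a5 y z t s) * (o3 y z t s ω - a3 y z t s) * (o4 y z t s ω - a4 y z t s)) ∂μ) :=
    integral_congr_ae (Filter.Eventually.of_forall fun ω => by ring)
  have i5 : (∫ ω, e ω * ((o2 y z t s ω - a2 y z t s) * (o4 y z t s ω - a4 y z t s) * (o5 y z t s ω - a5 y z t s)) ∂μ) =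
      (∫ ω, e ω * ((o5 y z t s ω - a5 y z t s) * (o2 y z t s ω - a2 y z t s) * (o4 y z t s ω - a4 y z t s)) ∂μ) :=
    integral_congr_ae (Filter.Eventually.of_forall fun ω => by ring)
  have i7 : (∫ ω, e ω * ((o2 y z t s ω - a2 y z t s) * (o3 y z t s ω - a3 y z t s) * (o5 y z t s ω - a5 y z t s)) ∂μ) =
      (∫ ω, e ω * ((o5 y z t s ω - a5 y z t s) * (o2 y z t s ω - a2 y z t s) * (o3 y z t s ω - a3 y z t s)) ∂μ) :=
    integral_congr_ae (Filter.Eventually.of_forall fun ω => by ring)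
  have i8 : (∫ ω, e ω * ((o1 y z t s ω - a1 y z t s) * (o5 y z t s ω - a5 y z t s)) ∂μ) =
      (∫ ω, e ω * ((o5 y z t s ω - a5 y z t s) * (o1 y z t s ω - a1 y z t s)) ∂μ) :=
    integral_congr_ae (Filter.Eventually.of_forall fun ω => by ring)
  have i11 : (∫ ω, e ω * ((o1 y z t s ω - a1 y z t s) * (o4 y z t s ω - a4 y z t s) * (o5 y z t s ω - a5 y z t s)) ∂μ) =
      (∫ ω, e ω * ((o5 y z t s ω - a5 y z t s) * (o1 y z t s ω - a1 y z t s) * (o4 y z t s ω - a4 y z t s)) ∂μ) :=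
    integral_congr_ae (Filter.Eventually.of_forall fun ω => by ring)
  have i13 : (∫ ω, e ω * ((o1 y z t s ω - a1 y z t s) * (o3 y z t s ω - a3 y z t s) * (o5 y z t s ω - a5 y z t s)) ∂μ) =
      (∫ ω, e ω * ((o5 y z t s ω - a5 y z t s) * (o1 y z t s ω - a1 y z t s) * (o3 y z t s ω - a3 y z t s)) ∂μ) :=
    integral_congr_ae (Filter.Eventually.of_forall fun ω => by ring)
  have i14 : (∫ ω, e ω * ((o2 y z t s ω - a2 y z t s) * (o5 y z t s ω - a5 y z t s)) ∂μ) =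
      (∫ ω, e ω * ((o5 y z t s ω - a5 y z t s) * (o2 y z t s ω - a2 y z t s)) ∂μ) :=
    integral_congr_ae (Filter.Eventually.of_forall fun ω => by ring)
  have i17 : (∫ ω, e ω * ((o1 y z t s ω - a1 y z t s) * (o2 y z t s ω - a2 y z t s) * (o5 y z t s ω - a5 y z t s)) ∂μ) =
      (∫ ω, e ω * ((o5 y z t s ω - a5 y z t s) * (o1 y z t s ω - a1 y z t s) * (o2 y z t s ω - a2 y z t s)) ∂μ) :=
    integral_congr_ae (Filter.Eventually.of_forall fun ω => by ring)
  have i18 : (∫ ω, e ω * ((o3 y z t s ω - a3 y z t s) * (o5 y z t s ω - a5 y z t s)) ∂μ) =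
      (∫ ω, e ω * ((o5 y z t s ω - a5 y z t s) * (o3 y z t s ω - a3 y z t s)) ∂μ) :=
    integral_congr_ae (Filter.Eventually.of_forall fun ω => by ring)
  have i20 : (∫ ω, e ω * ((o4 y z t s ω - a4 y z t s) * (o5 y z t s ω - a5 y z t s)) ∂μ) =
      (∫ ω, e ω * ((o5 y z t s ω - a5 y z t s) * (o4 y z t s ω - a4 y z t s)) ∂μ) :=
    integral_congr_ae (Filter.Eventually.of_forall fun ω => by ring)
  rw [i1, i3, i5, i7, i8, i11, i13, i14, i17, i18, i20]
  congr 1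
  ring

end Permutations

/-! ## §2. Toy -/

/-- Toy (the mechanism): two integrands that agree pointwise by commutativity have the same integral. -/
example {Ω : Type*} [MeasurableSpace Ω] (μ : Measure Ω) (f g : Ω → ℝ) : ∫ ω, f ω * g ω ∂μ = ∫ ω, g ω * f ω ∂μ :=
  integral_congr_ae (Filter.Eventually.of_forall fun ω => by ring)

end Summit.QuantumFields.BalabanUV.T4Continuum.NE7b.SupFifthKernelPermutations

end
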